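import Literature.MathematicalPhysics.QuantumFieldTheory.Balaban1983to89.Node00.TorusCoverPropSixGauge
import Literature.MathematicalPhysics.QuantumFieldTheory.Balaban1983to89.B12Eq115BackgroundPair

/-!
# NODE 00 — THE TORUS→`ℤᵈ` TWIN, FILE 4b: [6] PROPOSITION 6 AT NODE 00's `ℤᵈ` OBJECTS ⇒ THE LOCAL GAUGE OF [15] (152) ON A GRID CUBE OF THE TORUS —
# the lift `zdLift U` (FILE 1) in the class of the ambient member `cubeIdx'` (FILE 2), Prop. 6 at the datum `propCube`, the `SU(N)` normalisation (FILES 3b∕4a),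
# and the PUSH-DOWN of the gauge through the cover (injective on the non-wrapping cube): `∃ u : GaugeTransf P 0 (SU N), ∃ A`, `(ιU)^{ιu} = expI η_n A` on the bonds of
# `□ = cubeEnl P (LⁿM) a 0`, `‖A‖ ≤ 2r`, `‖∇^{η_n}A‖ ≤ 2r` on its derivative quadruples — the letters of `Node00.Gauge152OfClassTopStep`, for ONE cube

Cell `pub-ymgap`, seat `pub-ymgap-dag-n07-e` generation 10 (R141 (C) s3 «torus-vs-box twin», DAG node N07 = [15]; INTENT-25 programme FILE 28b, bus 2026-08-27).
NEW leaf; CONSUMED BY NAME, nothing modified: this seat's FILES 1, 2, 3b, 4a (`zdLift`, `inAk_zdLift_of_top`, `cubeIdx'`, `propCube`, `tol_of_level_pred`,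
`cubeExt_subset_box_propCube`, `exists_suGauge_letters_of_gaugedBoundB8`), node00-def-cube's `zdCub ∕ prop6Printed_zdCub_iff` (the Proposition-6 SLOT OF RECORD, read as
the hypothesis `B8.Prop6Printed … (fun i => zdCub (M_N(ℂ)) L i)` — n05-e's `prop6Printed_zdCub_of_printed` ∕ `…_real₃` supply it from [6] Thm 4 + Prop 3 ∕ [4]'s flat
letters), r15's `B15Eq112TorusCover.(cover, cover_eq_cover_iff)`, def-R's `cubeEnl`, node00-def-P11's `Sect2.regionOfSet`, r11's `B12RegularSpaces111.(gaugeU, expI, grad)`.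
`--kind definition --supports stmt-QuantumFields-20506` (K0⁶, WORDS-142).
[15] = [Balaban1985Variational]; [6] = [Balaban1985RegularSpaces]; [I] = [Balaban1987RG1]; [III] = [Balaban1988Convergent].

WHY.  This is the composition the four earlier files were written for, at ONE grid cube: given the Proposition-6 slot of N05's node at NODE 00's `ℤᵈ × M_N(ℂ)` member over
n05-a's whole index (`∀ i : ZdIdx d L`), a torus configuration `U` in the class (1.7)∕(1.9)-Top with thresholds `ε_m·η_m^{2,3}`, a grid cube `□ = cubeEnl P (LⁿM) a 0` of
scale `n ≥ 1` that does not wrap (`LⁿM < 2L^{m+K}`) whose Proposition-6 collar `𝔔̃` projects into the torus level set of scale `n − 1` (FILE 2 derives this from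
`Sect2.SeqSeparated` for `n ≥ 2` under `11d + 3L ≤ M₁`; at `n = 1` it is a condition on the top domain), and the two smallnesses of print («7dL²M′α₀ ≤ c₁» and the
`2π`-window of the determinant normalisation, both linear in `ε_{n−1}`), there is an `SU(N)`-VALUED torus gauge `u` and an exponent `A` with the three letters of
`Gauge152OfClassTopStep` on `□` at the constant `2r`, `r = 7dL²B₁M′·L³ε_{n−1}`, `M′ = M + 11d + L`.  FILE 29 wraps this into the token (every cube, both families,
`B₉·ε_n` with `ε_{n−1} ≤ 2ε_n`).

WHAT IS PROVED (kernel; `P : Params` any torus of record with `d ≥ 2`; NO estimate of Bałaban — Prop. 6 enters as the displayed hypothesis `hP6`).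
`zdLift_mem_specialUnitaryUnits` · `eq_of_cover_eq_of_mem_cubeExt` (the cover is injective on a box of side `≤` the period) · `add_e_mem_cubeExt_of_shift_mem_image`
(unit steps inside the projected cube lift to unit steps inside the box, side `<` period) · `cfgExp_eq_expI` (lit-balaban's `cfgExp η A x μ` IS r11's `expI η (A x μ)`)
(`Lⁿ·η_n = 1` is r11's `B12Eq115BackgroundPair.pow_mul_eta`) · ★★★ `exists_localGauge_cube_of_prop6` (the statement above).
HONEST FRAMING: a composition by name; [6] Proposition 6 at the member is the HYPOTHESIS `hP6` (N05's node; never asserted here); nothing of Bałaban discharged; N07 ∕ N05 ∕ K0⁶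
NOT discharged; counts unmoved (5∕27); one finite T⁴ programme at fixed ε — NOT continuum ∕ ℝ⁴ ∕ infinite volume ∕ OS ∕ mass gap ∕ Clay.  No `sorry`, no `instance`, no `notation`.
-/

noncomputable section

namespace Literature.MathematicalPhysics.QuantumFieldTheory.Balaban1983to89.Node00

open scoped Matrix.Norms.L2Operator
open Complex (I)
open NormedSpace (exp)
open B15Eq112TorusCover (cover per cover_eq_cover_iff)
open B15LatticeCubeTorus (pmul)
open B14DomainGeom (Pt)
open B14.Eq213MaximalDomains (side cubeExt)
open B7Prop1Explicit (e e_apply)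
open B7Prop1Local (InBox)
open B7Prop2Explicit (unitaryUnits mem_unitaryUnits)
open B7Prop2SpecialUnitary (specialUnitaryUnits mem_specialUnitaryUnits)
open B8Eq131Cubes (box tcube bLo bHi)
open B8Eq184Proof (cfgExp)
open B8LeafModelZd (ZdIdx)
open B8Ineq132 (InAk)
open B12RegularSpaces111 (gaugeU expI grad)
open B8Eq17ClassAkV1 (plaqsOf)
open B15DeterminingSets (bondsOf)

variable {P : Params} {N : ℕ} [NeZero N]

omit [NeZero N] in
/-- The lift of an `SU(N)`-valued torus field is `SU(N)`-valued (b07's `specialUnitaryUnits`). [cite: Balaban1985Averaging, p.18 («values in a Lie subgroup G of a unitary group U(N)»), p.20] -/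
theorem zdLift_mem_specialUnitaryUnits (U : GaugeField P 0 (SU N)) (x : B7Prop1Explicit.Site P.d) (μ : Fin P.d) :
    zdLift N U x μ ∈ specialUnitaryUnits (Fin N) := by
  rw [mem_specialUnitaryUnits, zdLift_apply, coe_ιSU]
  exact (U ⟨cover P x, μ⟩).prop

/-- **THE COVER IS INJECTIVE ON A BOX OF SIDE AT MOST THE PERIOD**: two points of `cubeExt S a 0` with the same image coincide (`S ≤ 2L^{m+K}`).
[cite: Balaban1987RG1, (0.1) p.251 (the torus by identification of boundary points)] -/
theorem eq_of_cover_eq_of_mem_cubeExt {S : ℕ} (hS : (S : ℤ) ≤ P.sitesPerDir 0) {a x x' : Pt P.d} (hx : x ∈ cubeExt S a 0) (hx' : x' ∈ cubeExt S a 0)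
    (h : cover P x = cover P x') : x = x' := by
  obtain ⟨v, hv⟩ := (cover_eq_cover_iff x x').1 h
  rw [hv]
  have hv0 : v = 0 := by
    funext i
    have h1 := hx i
    have h2 := hx' i
    rw [hv] at h2
    simp only [Pi.add_apply, pmul, B15Eq112TorusCover.per_apply, sub_zero, add_zero] at h1 h2
    have hn : (0 : ℤ) < (P.sitesPerDir 0 : ℤ) := by exact_mod_cast Nat.pos_of_ne_zero (P.sitesPerDir_ne_zero 0)
    rcases lt_trichotomy (v i) 0 with hlt | heq | hgt
    · have : (P.sitesPerDir 0 : ℤ) * v i ≤ (P.sitesPerDir 0 : ℤ) * (-1) := mul_le_mul_of_nonneg_left (by omega) hn.le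
      omega
    · exact heq
    · have : (P.sitesPerDir 0 : ℤ) * 1 ≤ (P.sitesPerDir 0 : ℤ) * v i := mul_le_mul_of_nonneg_left (by omega) hn.le
      omega
  simp [hv0]

/-- **UNIT STEPS INSIDE THE PROJECTED CUBE LIFT TO UNIT STEPS INSIDE THE BOX** (side `<` period): if `x ∈ cubeExt S a 0` and `(π x) + e_μ ∈ π(cubeExt S a 0)` then
`x + e_μ ∈ cubeExt S a 0`. [cite: Balaban1987RG1, (0.1) p.251 (bookkeeping on the torus)] -/
theorem add_e_mem_cubeExt_of_shift_mem_image {S : ℕ} (hS : (S : ℤ) < P.sitesPerDir 0) {a x : Pt P.d} (hx : x ∈ cubeExt S a 0) {μ : Fin P.d}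
    (h : (cover P x).shift μ ∈ cover P '' cubeExt S a 0) : x + e μ ∈ cubeExt S a 0 := by
  obtain ⟨x', hx', hc⟩ := h
  rw [← cover_add_e] at hc
  obtain ⟨v, hv⟩ := (cover_eq_cover_iff x' (x + e μ)).1 hc
  have hv0 : v = 0 := by
    funext i
    have h1 := hx i
    have h2 := hx' i
    have h3 := congrFun hv i
    simp only [Pi.add_apply, pmul, B15Eq112TorusCover.per_apply, sub_zero, add_zero, e_apply] at h1 h2 h3
    have hn : (0 : ℤ) < (P.sitesPerDir 0 : ℤ) := by exact_mod_cast Nat.pos_of_ne_zero (P.sitesPerDir_ne_zero 0)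
    rcases lt_trichotomy (v i) 0 with hlt | heq | hgt
    · have : (P.sitesPerDir 0 : ℤ) * v i ≤ (P.sitesPerDir 0 : ℤ) * (-1) := mul_le_mul_of_nonneg_left (by omega) hn.le
      split_ifs at h3 <;> omega
    · exact heq
    · have : (P.sitesPerDir 0 : ℤ) * 1 ≤ (P.sitesPerDir 0 : ℤ) * v i := mul_le_mul_of_nonneg_left (by omega) hn.le
      split_ifs at h3 <;> omega
  have : x + e μ = x' := by rw [hv, hv0]; simp
  rw [this]; exact hx'

omit [NeZero N] in
/-- lit-balaban's `cfgExp η A x μ` IS r11's `expI η (A x μ)` (both are the unit `e^{iηA}`). [cite: Balaban1985RegularSpaces, (1.36) p.82; Balaban1987RG1, (1.13) p.262] -/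
theorem cfgExp_eq_expI {d : ℕ} (η : ℝ) (A : B7Prop1Explicit.Site d → Fin d → MatA N) (x : B7Prop1Explicit.Site d) (μ : Fin d) :
    cfgExp η A x μ = expI η (A x μ) := by
  apply Units.ext
  rw [cfgExp, B7Prop1Explicit.val_expUnit, expI, Beta.BackgroundVertices.val_expUnit, RCLike.real_smul_eq_coe_smul (K := ℂ) η, smul_smul]
  rfl

/-- ★★★ **[6] PROPOSITION 6 AT NODE 00's `ℤᵈ` MEMBER ⇒ THE LOCAL GAUGE OF [15] (152) ON ONE GRID CUBE OF THE TORUS, `SU(N)`-VALUED, WITH ITS TWO LETTERS.**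
Hypotheses: `d ≥ 2`; the Proposition-6 slot `B8.Prop6Printed d L B₁ c₁ (zdCub (M_N ℂ) L ·)` over n05-a's whole index (N05's node at the member; `0 ≤ B₁`); a torus
configuration `U` with `|U(∂p) − 1| < ε_m η_m²` on `Sect2.omegaPlaqsTop Ω Ω₀ m` and `‖η(D*∂U)(b)‖ < ε_m η_m³` on `Sect2.omegaBondsTop Ω Ω₀ m`, `m ≤ kT`; a scale
`1 ≤ n ≤ kT + 1` with `0 < ε_{n−1}`; a grid cube `□ = cubeEnl P (LⁿM) a 0`, non-wrapping (`LⁿM < 2L^{m+K}`), whose Proposition-6 collar `𝔔̃ = tcube L (M·a)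
(M + 11d + L) L n` projects into the scale-`(n−1)` level set (`Ω₀` if `n = 1`; any `M`); print's smallness «7dL²M′α₀ ≤ c₁» at `α₀ = L³ε_{n−1}` and the `2π`-window of the
normalisation.  Conclusion: `∃ u : GaugeTransf P 0 (SU N)`, `∃ A`, on the bonds of `Sect2.regionOfSet P □`: `(ιU)^{ιu}(b) = expI η_n (A b)`, `‖A b‖ ≤ 2r`, and on its
derivative quadruples `‖∇^{η_n}_μ A_ν‖ ≤ 2r`, `r = 7dL²B₁M′·L³ε_{n−1}` ([15] (152) «L^jη|A|, (L^jη)²|∇A| < 9dL²B₁Mε₀» in the record's letters).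
[cite: Balaban1985Variational, (144)–(152) pp.300–301; Balaban1985RegularSpaces, Prop. 6 (1.135)–(1.136) p.99, p.98] -/
theorem exists_localGauge_cube_of_prop6 (hd : 2 ≤ P.d) {B₁ c₁ : ℝ} (hB₁ : 0 ≤ B₁)
    (hP6 : letI : CStarAlgebra (MatA N) := {}; B8.Prop6Printed P.d (P.L : ℝ) B₁ c₁ (fun i : ZdIdx P.d P.L => zdCub (MatA N) P.L i))
    {Ω : ℕ → Set (Site P 0)} {Ω₀ : Set (Site P 0)} {kT : ℕ} {ε : ℕ → ℝ} (U : GaugeField P 0 (SU N))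
    (hP : ∀ m, m ≤ kT → PlaqSmallOn (Sect2.omegaPlaqsTop Ω Ω₀ m) (ε m * P.eta m ^ 2) U)
    (hD : ∀ m, m ≤ kT → Sect2.CoDivSmallOn (Sect2.omegaBondsTop Ω Ω₀ m) (ε m * P.eta m ^ 3) U)
    {n : ℕ} (hn : 1 ≤ n) (hnk : n ≤ kT + 1) (hε : 0 < ε (n - 1)) {M : ℕ} (a : Pt P.d)
    (hSN : ((side P.L M n : ℕ) : ℤ) < P.sitesPerDir 0)
    (hcollar : cover P '' (cubeIdx' P n hn M a).Ω 0 ⊆ (if n - 1 = 0 then Ω₀ else Ω (n - 1)))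
    (hc₁ : 7 * P.d * (P.L : ℝ) ^ 2 * (propCube P n hn M a).M * ((P.L : ℝ) ^ 3 * ε (n - 1)) ≤ c₁)
    (h2π : (2 * boxWidth (bLo P.L (propCube P n hn M a).a (propCube P n hn M a).k 0)
        (bHi P.L (propCube P n hn M a).a (propCube P n hn M a).M (propCube P n hn M a).k 0) + 1) *
        (P.eta n * N * (7 * P.d * (P.L : ℝ) ^ 2 * B₁ * (propCube P n hn M a).M * ((P.L : ℝ) ^ 3 * ε (n - 1)) *
          ((P.L : ℝ) ^ (propCube P n hn M a).k * P.eta n)⁻¹)) < 2 * Real.pi) :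
    ∃ u : GaugeTransf P 0 (SU N), ∃ A : PBond P 0 → MatA N,
      (∀ b ∈ (Sect2.regionOfSet P (cubeEnl P (side P.L M n) a 0)).bonds,
          gaugeU (fun x => ιSU N (u x)) (fun b' => ιSU N (U b')) b = expI (P.eta n) (A b)) ∧
      (∀ b ∈ (Sect2.regionOfSet P (cubeEnl P (side P.L M n) a 0)).bonds,
          ‖A b‖ ≤ 2 * (7 * P.d * (P.L : ℝ) ^ 2 * B₁ * (propCube P n hn M a).M * ((P.L : ℝ) ^ 3 * ε (n - 1)))) ∧
      ∀ q ∈ (Sect2.regionOfSet P (cubeEnl P (side P.L M n) a 0)).dpairs,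
          ‖grad (P.eta n) q.2.1 (fun y => A ⟨y, q.2.2⟩) q.1‖ ≤ 2 * (7 * P.d * (P.L : ℝ) ^ 2 * B₁ * (propCube P n hn M a).M * ((P.L : ℝ) ^ 3 * ε (n - 1))) := by
  classical
  letI : CStarAlgebra (MatA N) := {}
  have hL : 2 ≤ P.L := P.hL.2
  have hL1 : 1 ≤ P.L := P.L_pos
  have hηpos : 0 < P.eta n := B3GkZeroTorusRescaled.eta_pos P n
  -- the member, the datum, the lift in the class
  set i : ZdIdx P.d P.L := cubeIdx' P n hn M a with hi
  set c := propCube P n hn M a with hc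
  set V := zdLift N U with hV
  set α : ℝ := (P.L : ℝ) ^ 3 * ε (n - 1) with hα
  have hαpos : 0 < α := by positivity
  have hInAk : InAk P.L i.k i.η α i.Ω V :=
    inAk_zdLift_of_top U hP hD hηpos (lvl := fun _ => n - 1) (fun j _ => by omega) (fun j _ => hcollar)
      (fun j hj => (tol_of_level_pred P hn hε.le hj).1) (fun j hj => (tol_of_level_pred P hn hε.le hj).2)
  have hVU : ∀ x κ, V x κ ∈ unitaryUnits (MatA N) := fun x κ => zdLift_mem_unitaryUnits U x κ
  -- [6] Proposition 6 at the member and the datum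
  have hG : GaugedBoundB8 P.L i.η V c (7 * P.d * (P.L : ℝ) ^ 2 * B₁ * c.M * α) :=
    (prop6Printed_zdCub_iff (fun i : ZdIdx P.d P.L => i) B₁ c₁).1 hP6 i α hαpos ⟨V, hVU⟩ hInAk c hc₁
  -- the SU(N) gauge with its letters on the box `𝔔`
  set r : ℝ := 7 * P.d * (P.L : ℝ) ^ 2 * B₁ * c.M * α with hr
  have hr0 : 0 ≤ r := by positivity
  have hη' : i.η = P.eta n := rfl
  rw [hη'] at hG
  obtain ⟨s, A', h1, h2, h3⟩ := exists_suGauge_letters_of_gaugedBoundB8 hd hL c V (zdLift_mem_specialUnitaryUnits U) hηpos hr0 hG h2π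
  have hscale : (P.L : ℝ) ^ c.k * P.eta n = 1 := B12Eq115BackgroundPair.pow_mul_eta P n
  simp only [hscale, inv_one, mul_one, one_pow] at h2 h3
  -- the lifted cube `□♯ ⊆ 𝔔`
  have hbox : cubeExt (side P.L M n) a 0 ⊆ box P.L c.a c.M c.k := cubeExt_subset_box_propCube P n hn M a
  -- push-down through the (injective) cover
  let u : GaugeTransf P 0 (SU N) := fun y =>
    if h : ∃ x, x ∈ cubeExt (side P.L M n) a 0 ∧ cover P x = y then s (Classical.choose h) else 1
  let A : PBond P 0 → MatA N := fun b =>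
    if h : ∃ x, x ∈ cubeExt (side P.L M n) a 0 ∧ cover P x = b.src then A' (Classical.choose h) b.dir else 0
  have hu : ∀ x, x ∈ cubeExt (side P.L M n) a 0 → u (cover P x) = s x := by
    intro x hx
    have hex : ∃ x', x' ∈ cubeExt (side P.L M n) a 0 ∧ cover P x' = cover P x := ⟨x, hx, rfl⟩
    simp only [u, dif_pos hex]
    rw [eq_of_cover_eq_of_mem_cubeExt hSN.le (Classical.choose_spec hex).1 hx (Classical.choose_spec hex).2]
  have hA : ∀ x, x ∈ cubeExt (side P.L M n) a 0 → ∀ μ, A ⟨cover P x, μ⟩ = A' x μ := by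
    intro x hx μ
    have hex : ∃ x', x' ∈ cubeExt (side P.L M n) a 0 ∧ cover P x' = cover P x := ⟨x, hx, rfl⟩
    simp only [A, dif_pos hex]
    rw [eq_of_cover_eq_of_mem_cubeExt hSN.le (Classical.choose_spec hex).1 hx (Classical.choose_spec hex).2]
  -- a site of `□` is the image of a point of `□♯`
  have hlift : ∀ y, y ∈ cubeEnl P (side P.L M n) a 0 → ∃ x, x ∈ cubeExt (side P.L M n) a 0 ∧ cover P x = y := by
    intro y hy
    obtain ⟨x, hx, rfl⟩ := hy
    simp only [Nat.zero_mul, Nat.cast_zero] at hx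
    exact ⟨x, hx, rfl⟩
  have himage : ∀ y, y ∈ cubeEnl P (side P.L M n) a 0 → y ∈ cover P '' cubeExt (side P.L M n) a 0 := fun y hy => by
    obtain ⟨x, hx, rfl⟩ := hlift y hy; exact ⟨x, hx, rfl⟩
  refine ⟨u, A, fun b hb => ?_, fun b hb => ?_, fun q hq => ?_⟩
  · obtain ⟨x, hx, hxs⟩ := hlift b.src hb.1
    have hx' : x + e b.dir ∈ cubeExt (side P.L M n) a 0 :=
      add_e_mem_cubeExt_of_shift_mem_image hSN hx (by rw [hxs]; exact himage _ hb.2)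
    have hb' : b = ⟨cover P x, b.dir⟩ := by cases b; simp only at hxs; rw [hxs]
    rw [hb', hA x hx]
    have hgauge := h1 x b.dir (hbox hx) (hbox hx')
    rw [cfgExp_eq_expI] at hgauge
    rw [← hgauge]
    simp only [gaugeU, B7Prop1Explicit.gaugeAct, PBond.tgt, ← cover_add_e, hu x hx, hu (x + e b.dir) hx', hV, zdLift_apply]
  · obtain ⟨x, hx, hxs⟩ := hlift b.src hb.1
    have hx' : x + e b.dir ∈ cubeExt (side P.L M n) a 0 :=
      add_e_mem_cubeExt_of_shift_mem_image hSN hx (by rw [hxs]; exact himage _ hb.2)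
    have hb' : b = ⟨cover P x, b.dir⟩ := by cases b; simp only at hxs; rw [hxs]
    rw [hb', hA x hx]
    exact h2 x b.dir (hbox hx) (hbox hx')
  · obtain ⟨hq1, hq2, hq3, -⟩ := hq
    obtain ⟨x, hx, hxs⟩ := hlift q.1 hq1
    have hxμ : x + e q.2.1 ∈ cubeExt (side P.L M n) a 0 :=
      add_e_mem_cubeExt_of_shift_mem_image hSN hx (by rw [hxs]; exact himage _ hq2)
    have hxν : x + e q.2.2 ∈ cubeExt (side P.L M n) a 0 :=
      add_e_mem_cubeExt_of_shift_mem_image hSN hx (by rw [hxs]; exact himage _ hq3)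
    rw [grad, ← hxs, ← cover_add_e, hA x hx, hA (x + e q.2.1) hxμ, norm_smul, norm_inv, Complex.norm_real, Real.norm_eq_abs, abs_of_pos hηpos]
    calc (P.eta n)⁻¹ * ‖A' (x + e q.2.1) q.2.2 - A' x q.2.2‖ ≤ (P.eta n)⁻¹ * (2 * (P.eta n * r)) :=
          mul_le_mul_of_nonneg_left (h3 x q.2.1 q.2.2 (hbox hx) (hbox hxμ) (hbox hxν)) (inv_nonneg.2 hηpos.le)
      _ = 2 * r := by field_simp

end Literature.MathematicalPhysics.QuantumFieldTheory.Balaban1983to89.Node00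

end
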